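import Summits.AtomisticToContinuum.Crystallization.Theorems.PhononStability.Negative.Mirror
import Summits.AtomisticToContinuum.Crystallization.Theorems.HcpLiouville.Negative.EquilLoadBearing
import Literature.MathematicalPhysics.StatisticalMechanics.LennardJonesClusters

/-!
# Route `ExcessDecayLiouville`: geometry of the affine hcp two-lattice site set

Elementary metric facts about the site set `Sites₀ t A = {t m + A z : m ∈ {0,1}, z ∈ Λ₀}` of an
admissible datum (`Adm₀ A`: `‖A − 0.97 R‖ ≤ 1/40` for a linear isometry `R`; `Inner₀ t A`: hcp-like inner
displacement), needed by every statement of the route that speaks of two-way matching (`ExcessDecay`,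
`HcpLiouville`, `GrainsGlue`, `LimitGlue`):

* `norm_le_of_adm₀` : `‖A‖ ≤ 199/200`; `injective_of_adm₀`, `surjective_of_adm₀`;
* `exists_mem_Λ₀_norm_sub_le` : `Λ₀` has covering radius `≤ 11/10` (coordinate rounding);
* `exists_site_dist_le` : every point of `ℝ³` is within `11/10` of a site of EACH sublattice;
* `norm_sub_ge_of_adm₀` : distinct sites of one sublattice are `≥ 189/200` apart;
* `exists_adjacent_sites` : every closed ball of radius `≥ 11/5` contains two sites of sublattice `0`
  at mutual distance in `[189/200, 199/200]`;
* `sep_le_of_matched` : consequently a `δ`-separated set with `δ > 199/200 + 2ε` (`ε < 189/400`) cannot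
  cover all sites of such a ball within `ε` — the large-separation regime of `ExcessDecay` is vacuous;
* `one_le_norm_motif_add` : the motif vector `w + √(2/3)e₃` is at distance `≥ 1` from `Λ₀`, whence
  `dist_sites_ge` : distinct sites (either sublattice) are `≥ 23/25` apart under `Inner₀`;
* `site_unique` / `particle_unique` : uniqueness of the matched site (`ε < 23/50`) / particle (`2ε < δ`);
* `finite_sites_dist_le` : local finiteness of the site set (packing).

All `[folklore]`; helper lemmas for item stmt-AtomisticToContinuum-9334, nothing here closes an item.
-/

noncomputable section

namespace Summit.AtomisticToContinuum.Crystallization.Theorems.ExcessDecayLiouville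

open scoped BigOperators Topology InnerProductSpace
open Literature.MathematicalPhysics.StatisticalMechanics
open Summit.AtomisticToContinuum.Crystallization.Theorems.PhononStabilityNegative
open Summit.AtomisticToContinuum.Crystallization.Theorems

/-! ## Admissible cells -/

/-- An admissible cell has operator norm `≤ 0.97 + 1/40 = 199/200`. [folklore] -/
theorem norm_le_of_adm₀ {A : (EuclideanSpace ℝ (Fin 3)) →L[ℝ] (EuclideanSpace ℝ (Fin 3))} (hA : Adm₀ A) : ‖A‖ ≤ 199 / 200 := by
  obtain ⟨R, hR⟩ := hA
  have h2 : ‖(R.toContinuousLinearEquiv : (EuclideanSpace ℝ (Fin 3)) →L[ℝ] (EuclideanSpace ℝ (Fin 3)))‖ ≤ 1 := by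
    refine ContinuousLinearMap.opNorm_le_bound _ zero_le_one fun x => ?_
    simp
  have h1 : ‖(97 / 100 : ℝ) • (R.toContinuousLinearEquiv : (EuclideanSpace ℝ (Fin 3)) →L[ℝ] (EuclideanSpace ℝ (Fin 3)))‖ ≤ 97 / 100 := by
    rw [norm_smul, Real.norm_eq_abs, abs_of_pos (by norm_num : (0 : ℝ) < 97 / 100)]
    nlinarith [h2, norm_nonneg (R.toContinuousLinearEquiv : (EuclideanSpace ℝ (Fin 3)) →L[ℝ] (EuclideanSpace ℝ (Fin 3)))]
  have h3 := norm_le_insert' A ((97 / 100 : ℝ) • (R.toContinuousLinearEquiv : (EuclideanSpace ℝ (Fin 3)) →L[ℝ] (EuclideanSpace ℝ (Fin 3))))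
  -- ‖A‖ ≤ ‖B‖ + ‖A - B‖
  linarith

/-- `‖A v‖ ≤ (199/200) ‖v‖` for an admissible cell. [folklore] -/
theorem norm_apply_le_of_adm₀ {A : (EuclideanSpace ℝ (Fin 3)) →L[ℝ] (EuclideanSpace ℝ (Fin 3))} (hA : Adm₀ A) (v : (EuclideanSpace ℝ (Fin 3))) : ‖A v‖ ≤ 199 / 200 * ‖v‖ :=
  (A.le_opNorm v).trans (mul_le_mul_of_nonneg_right (norm_le_of_adm₀ hA) (norm_nonneg _))

/-- An admissible cell is injective (`‖A v‖ ≥ 0.945 ‖v‖`). [folklore] -/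
theorem injective_of_adm₀ {A : (EuclideanSpace ℝ (Fin 3)) →L[ℝ] (EuclideanSpace ℝ (Fin 3))} (hA : Adm₀ A) : Function.Injective A := by
  rw [← A.coe_coe, ← LinearMap.ker_eq_bot, LinearMap.ker_eq_bot']
  intro v hv
  have h := hcpLiouvilleAdm_norm_le hA v
  have hv' : ‖A v‖ = 0 := by rw [show A v = 0 from hv, norm_zero]
  have : ‖v‖ ≤ 0 := by nlinarith [norm_nonneg v]
  exact norm_le_zero_iff.1 this

/-- An admissible cell is surjective (an injective endomorphism of `ℝ³`). [folklore] -/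
theorem surjective_of_adm₀ {A : (EuclideanSpace ℝ (Fin 3)) →L[ℝ] (EuclideanSpace ℝ (Fin 3))} (hA : Adm₀ A) : Function.Surjective A := by
  have : Function.Injective (A : (EuclideanSpace ℝ (Fin 3)) →ₗ[ℝ] (EuclideanSpace ℝ (Fin 3))) := injective_of_adm₀ hA
  exact LinearMap.injective_iff_surjective.1 this

/-! ## Covering radius of `Λ₀` and of the site set -/

/-- **Coordinate rounding in `Λ₀`**: every `y ∈ ℝ³` is within `11/10` of a lattice vector
(`|Δx₀| ≤ 1/2`, `|Δx₁| ≤ √3/4`, `|Δx₂| ≤ √(2/3)`, so `‖Δ‖² ≤ 53/48`). [folklore] -/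
theorem exists_mem_Λ₀_norm_sub_le (y : (EuclideanSpace ℝ (Fin 3))) : ∃ z ∈ Λ₀, ‖y - z‖ ≤ 11 / 10 := by
  set c₃ : ℝ := 2 * Real.sqrt (2 / 3) with hc₃
  set c₂ : ℝ := √3 / 2 with hc₂
  have h3 : (0 : ℝ) < √3 := Real.sqrt_pos.2 (by norm_num)
  have h23 : (0 : ℝ) < Real.sqrt (2 / 3) := Real.sqrt_pos.2 (by norm_num)
  have hc₂pos : 0 < c₂ := by rw [hc₂]; positivity
  have hc₃pos : 0 < c₃ := by rw [hc₃]; positivity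
  set k : ℤ := round (y 2 / c₃) with hk
  set j : ℤ := round (y 1 / c₂) with hj
  set i : ℤ := round (y 0 - j * 2⁻¹) with hi
  refine ⟨(i : ℝ) • triangularVec₁ 1 + (j : ℝ) • triangularVec₂ 1 +
    (k : ℝ) • layerNormal (2 * Real.sqrt (2 / 3)), ⟨i, j, k, rfl⟩, ?_⟩
  obtain ⟨hz0, hz1, hz2⟩ := hcpLiouvilleLam_apply i j k
  set z : (EuclideanSpace ℝ (Fin 3)) := (i : ℝ) • triangularVec₁ 1 + (j : ℝ) • triangularVec₂ 1 +
    (k : ℝ) • layerNormal (2 * Real.sqrt (2 / 3)) with hzdef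
  -- the three coordinate errors
  have e0 : |y 0 - z 0| ≤ 1 / 2 := by
    rw [hz0]
    have := abs_sub_round (y 0 - j * 2⁻¹)
    rw [← hi] at this
    calc |y 0 - (i + j * 2⁻¹)| = |y 0 - j * 2⁻¹ - i| := by ring_nf
      _ ≤ 1 / 2 := this
  have e1 : |y 1 - z 1| ≤ √3 / 4 := by
    rw [hz1]
    have hr := abs_sub_round (y 1 / c₂)
    rw [← hj] at hr
    have : y 1 - j * (√3 / 2) = c₂ * (y 1 / c₂ - j) := by
      rw [hc₂]; field_simp
    rw [this, abs_mul, abs_of_pos hc₂pos]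
    calc c₂ * |y 1 / c₂ - j| ≤ c₂ * (1 / 2) := by gcongr
      _ = √3 / 4 := by rw [hc₂]; ring
  have e2 : |y 2 - z 2| ≤ Real.sqrt (2 / 3) := by
    rw [hz2]
    have hr := abs_sub_round (y 2 / c₃)
    rw [← hk] at hr
    have : y 2 - k * (2 * Real.sqrt (2 / 3)) = c₃ * (y 2 / c₃ - k) := by
      rw [hc₃]; field_simp
    rw [this, abs_mul, abs_of_pos hc₃pos]
    calc c₃ * |y 2 / c₃ - k| ≤ c₃ * (1 / 2) := by gcongr
      _ = Real.sqrt (2 / 3) := by rw [hc₃]; ring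
  have hsq : ‖y - z‖ ^ 2 ≤ 53 / 48 := by
    rw [EuclideanSpace.norm_sq_eq, Fin.sum_univ_three]
    simp only [PiLp.sub_apply, Real.norm_eq_abs, sq_abs]
    have s3 : (√3 : ℝ) ^ 2 = 3 := Real.sq_sqrt (by norm_num)
    have s23 : (Real.sqrt (2 / 3)) ^ 2 = 2 / 3 := Real.sq_sqrt (by norm_num)
    have a0 : (y 0 - z 0) ^ 2 ≤ 1 / 4 := by
      have := e0; rw [abs_le] at this; nlinarith [this.1, this.2]
    have a1 : (y 1 - z 1) ^ 2 ≤ 3 / 16 := by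
      have h := e1; rw [abs_le] at h
      have : (y 1 - z 1) ^ 2 ≤ (√3 / 4) ^ 2 := by nlinarith [h.1, h.2, h3]
      nlinarith [this, s3]
    have a2 : (y 2 - z 2) ^ 2 ≤ 2 / 3 := by
      have h := e2; rw [abs_le] at h
      have : (y 2 - z 2) ^ 2 ≤ (Real.sqrt (2 / 3)) ^ 2 := by nlinarith [h.1, h.2, h23]
      linarith [this, s23]
    linarith
  have hn : 0 ≤ ‖y - z‖ := norm_nonneg _
  nlinarith [hsq, hn]

/-- **Covering radius of the site set**: for an admissible cell, every point of `ℝ³` is within `11/10`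
of a site of each sublattice `m`. [folklore] -/
theorem exists_site_dist_le {A : (EuclideanSpace ℝ (Fin 3)) →L[ℝ] (EuclideanSpace ℝ (Fin 3))} (hA : Adm₀ A) (t : Fin 2 → (EuclideanSpace ℝ (Fin 3))) (m : Fin 2) (x : (EuclideanSpace ℝ (Fin 3))) :
    ∃ z ∈ Λ₀, dist (t m + A z) x ≤ 11 / 10 := by
  obtain ⟨y, hy⟩ := surjective_of_adm₀ hA (x - t m)
  obtain ⟨z, hz, hyz⟩ := exists_mem_Λ₀_norm_sub_le y
  refine ⟨z, hz, ?_⟩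
  rw [dist_eq_norm]
  have : t m + A z - x = A (z - y) := by rw [map_sub, hy]; abel
  rw [this]
  calc ‖A (z - y)‖ ≤ 199 / 200 * ‖z - y‖ := norm_apply_le_of_adm₀ hA _
    _ ≤ 199 / 200 * (11 / 10) := by rw [norm_sub_rev]; gcongr
    _ ≤ 11 / 10 := by norm_num

/-! ## Separation of the site set -/

/-- Distinct sites of one sublattice are `≥ 189/200` apart. [folklore] -/
theorem norm_sub_ge_of_adm₀ {A : (EuclideanSpace ℝ (Fin 3)) →L[ℝ] (EuclideanSpace ℝ (Fin 3))} (hA : Adm₀ A) {z z' : (EuclideanSpace ℝ (Fin 3))} (hz : z ∈ Λ₀) (hz' : z' ∈ Λ₀)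
    (hne : z ≠ z') : 189 / 200 ≤ ‖A z - A z'‖ := by
  rw [← map_sub]
  have h1 : 1 ≤ ‖z - z'‖ := hcpLiouvilleLam_one_le_norm (hcpLiouvilleLam_sub_mem hz hz') (sub_ne_zero.2 hne)
  have h2 := hcpLiouvilleAdm_norm_le hA (z - z')
  linarith

/-- `u = triangularVec₁ 1 ∈ Λ₀`. [folklore] -/
theorem triangularVec₁_mem_Λ₀ : triangularVec₁ 1 ∈ Λ₀ :=
  ⟨1, 0, 0, by simp⟩

/-- `‖u‖ = 1`. [folklore] -/
theorem norm_triangularVec₁ : ‖(triangularVec₁ 1 : (EuclideanSpace ℝ (Fin 3)))‖ = 1 := by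
  have h := hcpLiouvilleLam_norm_sq 1 0 0
  simp only [Int.cast_one, one_smul, Int.cast_zero, zero_smul, add_zero] at h
  have hn : 0 ≤ ‖(triangularVec₁ 1 : (EuclideanSpace ℝ (Fin 3)))‖ := norm_nonneg _
  nlinarith [h, hn]

/-- **Two adjacent sites in every ball of radius `≥ 11/5`**: sites `t 0 + A z` and `t 0 + A (z + u)` of
sublattice `0`, both in the closed ball, at mutual distance `‖A u‖ ∈ [189/200, 199/200]`. [folklore] -/
theorem exists_adjacent_sites {A : (EuclideanSpace ℝ (Fin 3)) →L[ℝ] (EuclideanSpace ℝ (Fin 3))} (hA : Adm₀ A) (t : Fin 2 → (EuclideanSpace ℝ (Fin 3))) (c : (EuclideanSpace ℝ (Fin 3))) {r : ℝ}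
    (hr : 11 / 5 ≤ r) :
    ∃ z ∈ Λ₀, ∃ z' ∈ Λ₀, z ≠ z' ∧ dist (t 0 + A z) c ≤ r ∧ dist (t 0 + A z') c ≤ r ∧
      dist (t 0 + A z) (t 0 + A z') ≤ 199 / 200 := by
  obtain ⟨z, hz, hzc⟩ := exists_site_dist_le hA t 0 c
  have hu : ‖A (triangularVec₁ 1)‖ ≤ 199 / 200 := by
    have := norm_apply_le_of_adm₀ hA (triangularVec₁ 1)
    rw [norm_triangularVec₁, mul_one] at this
    exact this
  have hd : dist (t 0 + A z) (t 0 + A (z + triangularVec₁ 1)) = ‖A (triangularVec₁ 1)‖ := by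
    rw [dist_eq_norm, map_add]
    have : t 0 + A z - (t 0 + (A z + A (triangularVec₁ 1))) = -A (triangularVec₁ 1) := by abel
    rw [this, norm_neg]
  refine ⟨z, hz, z + triangularVec₁ 1, hcpLiouvilleLam_add_mem hz triangularVec₁_mem_Λ₀, ?_, hzc.trans
    (by linarith), ?_, ?_⟩
  · intro h
    have : (triangularVec₁ 1 : (EuclideanSpace ℝ (Fin 3))) = 0 := by
      have := congrArg (· - z) h
      simpa using this.symm
    have hn := norm_triangularVec₁
    rw [this, norm_zero] at hn
    norm_num at hn
  · calc dist (t 0 + A (z + triangularVec₁ 1)) c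
        ≤ dist (t 0 + A (z + triangularVec₁ 1)) (t 0 + A z) + dist (t 0 + A z) c := dist_triangle _ _ _
      _ ≤ 199 / 200 + 11 / 10 := by rw [dist_comm, hd]; exact add_le_add hu hzc
      _ ≤ r := by linarith
  · rw [hd]; exact hu

/-- **The large-separation regime is vacuous**: if every site of sublattice `0` in the closed ball
`dist · c ≤ r`, `r ≥ 11/5`, is within `ε` of a point of the `δ`-separated set `X`, then
`δ ≤ 199/200 + 2ε` (provided `ε < 189/400`, so that the two adjacent sites are served by distinct
points). [folklore] -/
theorem sep_le_of_matched {X : Set (EuclideanSpace ℝ (Fin 3))} {δ ε r : ℝ} {c : (EuclideanSpace ℝ (Fin 3))} {t : Fin 2 → (EuclideanSpace ℝ (Fin 3))} {A : (EuclideanSpace ℝ (Fin 3)) →L[ℝ] (EuclideanSpace ℝ (Fin 3))}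
    (hA : Adm₀ A) (hsep : ∀ p ∈ X, ∀ q ∈ X, p ≠ q → δ ≤ dist p q)
    (hcov : ∀ z ∈ Λ₀, dist (t 0 + A z) c ≤ r → ∃ p ∈ X, dist p (t 0 + A z) ≤ ε)
    (hε : ε < 189 / 400) (hr : 11 / 5 ≤ r) : δ ≤ 199 / 200 + 2 * ε := by
  obtain ⟨z, hz, z', hz', hne, hzc, hz'c, hzz'⟩ := exists_adjacent_sites hA t c hr
  obtain ⟨p, hp, hpz⟩ := hcov z hz hzc
  obtain ⟨p', hp', hp'z'⟩ := hcov z' hz' hz'c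
  have hfar : 189 / 200 ≤ dist (t 0 + A z) (t 0 + A z') := by
    rw [dist_eq_norm, add_sub_add_left_eq_sub]
    exact norm_sub_ge_of_adm₀ hA hz hz' hne
  have hpp' : p ≠ p' := by
    rintro rfl
    have := dist_triangle_left (t 0 + A z) (t 0 + A z') p
    linarith
  have h := hsep p hp p' hp' hpp'
  have := dist_triangle4 p (t 0 + A z) (t 0 + A z') p'
  rw [dist_comm (t 0 + A z') p'] at this
  linarith

/-! ## The two sublattices: the hcp motif vector is at distance `≥ 1` from `Λ₀` -/

/-- Integer inequality behind the inter-sublattice distance: `3(2i+j+1)² + (1+3j)² ≥ 4`. [folklore] -/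
theorem four_le_motif_form (i j : ℤ) : 4 ≤ 3 * (2 * i + j + 1) ^ 2 + (1 + 3 * j) ^ 2 := by
  by_cases ha : 2 * i + j + 1 = 0
  · have hj : j = -1 - 2 * i := by omega
    subst hj
    have hb : (1 : ℤ) ≤ |1 + 3 * i| := Int.one_le_abs (by omega)
    nlinarith [sq_abs (1 + 3 * i), ha]
  · have ha' : (1 : ℤ) ≤ |2 * i + j + 1| := Int.one_le_abs ha
    have hb : (1 : ℤ) ≤ |1 + 3 * j| := Int.one_le_abs (by omega)
    nlinarith [sq_abs (2 * i + j + 1), sq_abs (1 + 3 * j)]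

/-- **The hcp motif vector `w + √(2/3)e₃` is at distance `≥ 1` from every vector of `Λ₀`** (it realises
the unit nearest-neighbour distance between the two sublattices of the unit hcp two-lattice):
`‖w + √(2/3)e₃ + λ‖² = (2i+j+1)²/4 + (1+3j)²/12 + (2/3)(1+2k)² ≥ 1/3 + 2/3`. [folklore] -/
theorem one_le_norm_motif_add {l : (EuclideanSpace ℝ (Fin 3))} (hl : l ∈ Λ₀) :
    1 ≤ ‖barlowOffset 1 + layerNormal (Real.sqrt (2 / 3)) + l‖ := by
  obtain ⟨i, j, k, rfl⟩ := hl
  obtain ⟨hz0, hz1, hz2⟩ := hcpLiouvilleLam_apply i j k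
  set z : (EuclideanSpace ℝ (Fin 3)) := (i : ℝ) • triangularVec₁ 1 + (j : ℝ) • triangularVec₂ 1 +
    (k : ℝ) • layerNormal (2 * Real.sqrt (2 / 3)) with hzdef
  set v : (EuclideanSpace ℝ (Fin 3)) := barlowOffset 1 + layerNormal (Real.sqrt (2 / 3)) + z with hv
  have hv0 : v 0 = 1 / 2 + (i + j * 2⁻¹) := by
    rw [hv, PiLp.add_apply, PiLp.add_apply, hz0]; simp [barlowOffset, layerNormal]
  have hv1 : v 1 = √3 / 6 + j * (√3 / 2) := by
    rw [hv, PiLp.add_apply, PiLp.add_apply, hz1]; simp [barlowOffset, layerNormal]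
  have hv2 : v 2 = Real.sqrt (2 / 3) + k * (2 * Real.sqrt (2 / 3)) := by
    rw [hv, PiLp.add_apply, PiLp.add_apply, hz2]; simp [barlowOffset, layerNormal]
  have s3 : (√3 : ℝ) ^ 2 = 3 := Real.sq_sqrt (by norm_num)
  have s23 : (Real.sqrt (2 / 3)) ^ 2 = 2 / 3 := Real.sq_sqrt (by norm_num)
  have hform : (4 : ℝ) ≤ 3 * (2 * i + j + 1) ^ 2 + (1 + 3 * j) ^ 2 := by
    exact_mod_cast four_le_motif_form i j
  have hk : (1 : ℝ) ≤ (1 + 2 * (k : ℝ)) ^ 2 := by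
    have hk0 : 1 + 2 * k ≠ 0 := by omega
    have : (1 : ℤ) ≤ (1 + 2 * k) ^ 2 := by
      nlinarith [Int.one_le_abs hk0, sq_abs (1 + 2 * k)]
    exact_mod_cast this
  have hsq : 1 ≤ ‖v‖ ^ 2 := by
    rw [EuclideanSpace.norm_sq_eq, Fin.sum_univ_three]
    simp only [Real.norm_eq_abs, sq_abs]
    rw [hv0, hv1, hv2]
    nlinarith [s3, s23, hform, hk]
  nlinarith [norm_nonneg v, hsq]

/-- **Inter-sublattice separation**: for an admissible datum with hcp-like inner displacement, a site
of sublattice `1` and a site of sublattice `0` are `≥ 189/200 − 1/40 = 23/25` apart. [folklore] -/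
theorem dist_sites_cross_ge {A : (EuclideanSpace ℝ (Fin 3)) →L[ℝ] (EuclideanSpace ℝ (Fin 3))} {t : Fin 2 → (EuclideanSpace ℝ (Fin 3))} (hA : Adm₀ A) (hI : Inner₀ t A)
    {z z' : (EuclideanSpace ℝ (Fin 3))} (hz : z ∈ Λ₀) (hz' : z' ∈ Λ₀) :
    23 / 25 ≤ dist (t 1 + A z') (t 0 + A z) := by
  set d : (EuclideanSpace ℝ (Fin 3)) := t 1 - t 0 - A (barlowOffset 1 + layerNormal (Real.sqrt (2 / 3))) with hd
  have hdn : ‖d‖ ≤ 1 / 40 := hI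
  have hmem : z' - z ∈ Λ₀ := hcpLiouvilleLam_sub_mem hz' hz
  have h1 : 1 ≤ ‖barlowOffset 1 + layerNormal (Real.sqrt (2 / 3)) + (z' - z)‖ :=
    one_le_norm_motif_add hmem
  have h2 := hcpLiouvilleAdm_norm_le hA (barlowOffset 1 + layerNormal (Real.sqrt (2 / 3)) + (z' - z))
  have hsplit : t 1 + A z' - (t 0 + A z) =
      A (barlowOffset 1 + layerNormal (Real.sqrt (2 / 3)) + (z' - z)) + d := by
    rw [hd, map_add, map_sub]; abel
  rw [dist_eq_norm, hsplit]
  have h3 := norm_sub_norm_le (A (barlowOffset 1 + layerNormal (Real.sqrt (2 / 3)) + (z' - z))) (-d)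
  rw [sub_neg_eq_add, norm_neg] at h3
  nlinarith

/-- **The site set is uniformly discrete**: distinct sites of an admissible datum with hcp-like inner
displacement are `≥ 23/25` apart. [folklore] -/
theorem dist_sites_ge {A : (EuclideanSpace ℝ (Fin 3)) →L[ℝ] (EuclideanSpace ℝ (Fin 3))} {t : Fin 2 → (EuclideanSpace ℝ (Fin 3))} (hA : Adm₀ A) (hI : Inner₀ t A)
    {p q : (EuclideanSpace ℝ (Fin 3))} (hp : p ∈ Sites₀ t A) (hq : q ∈ Sites₀ t A) (hpq : p ≠ q) : 23 / 25 ≤ dist p q := by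
  obtain ⟨m, z, hz, rfl⟩ := hp
  obtain ⟨m', z', hz', rfl⟩ := hq
  fin_cases m <;> fin_cases m'
  · have hne : z ≠ z' := fun h => hpq (by simp [h])
    have := norm_sub_ge_of_adm₀ hA hz hz' hne
    simp only [Fin.zero_eta, dist_eq_norm, add_sub_add_left_eq_sub]
    linarith
  · simp only [Fin.zero_eta, Fin.mk_one]
    rw [dist_comm]; exact dist_sites_cross_ge hA hI hz hz'
  · simp only [Fin.zero_eta, Fin.mk_one]
    exact dist_sites_cross_ge hA hI hz' hz
  · have hne : z ≠ z' := fun h => hpq (by simp [h])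
    have := norm_sub_ge_of_adm₀ hA hz hz' hne
    simp only [Fin.mk_one, dist_eq_norm, add_sub_add_left_eq_sub]
    linarith

/-! ## Matching: uniqueness of the matched site / particle -/

/-- Under a tolerance `ε < 23/50`, a point is within `ε` of at most one site. [folklore] -/
theorem site_unique {A : (EuclideanSpace ℝ (Fin 3)) →L[ℝ] (EuclideanSpace ℝ (Fin 3))} {t : Fin 2 → (EuclideanSpace ℝ (Fin 3))} (hA : Adm₀ A) (hI : Inner₀ t A) {ε : ℝ}
    (hε : ε < 23 / 50) {p s s' : (EuclideanSpace ℝ (Fin 3))} (hs : s ∈ Sites₀ t A) (hs' : s' ∈ Sites₀ t A)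
    (h : dist p s ≤ ε) (h' : dist p s' ≤ ε) : s = s' := by
  by_contra hne
  have := dist_sites_ge hA hI hs hs' hne
  have := dist_triangle_left s s' p
  linarith

/-- In a `δ`-separated set with `2ε < δ`, a site is within `ε` of at most one point. [folklore] -/
theorem particle_unique {X : Set (EuclideanSpace ℝ (Fin 3))} {δ ε : ℝ} (hsep : ∀ p ∈ X, ∀ q ∈ X, p ≠ q → δ ≤ dist p q)
    (hε : 2 * ε < δ) {p p' s : (EuclideanSpace ℝ (Fin 3))} (hp : p ∈ X) (hp' : p' ∈ X) (h : dist p s ≤ ε)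
    (h' : dist p' s ≤ ε) : p = p' := by
  by_contra hne
  have := hsep p hp p' hp' hne
  have := dist_triangle_right p p' s
  linarith

/-- **Local finiteness of the site set**: only finitely many sites lie in any ball (a `23/25`-separated
set meets a ball of radius `R` in at most `(2R/(23/25) + 1)³` points, by packing). [folklore] -/
theorem finite_sites_dist_le {A : (EuclideanSpace ℝ (Fin 3)) →L[ℝ] (EuclideanSpace ℝ (Fin 3))} {t : Fin 2 → (EuclideanSpace ℝ (Fin 3))} (hA : Adm₀ A) (hI : Inner₀ t A)
    (x : (EuclideanSpace ℝ (Fin 3))) (R : ℝ) : Set.Finite {s : (EuclideanSpace ℝ (Fin 3)) | s ∈ Sites₀ t A ∧ dist s x ≤ R} := by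
  classical
  rcases le_or_gt 0 R with hR | hR
  · by_contra hinf
    obtain ⟨n, hn⟩ : ∃ n : ℕ, (2 * R / (23 / 25) + 1) ^ 3 < n := exists_nat_gt _
    obtain ⟨T, hTsub, hTcard⟩ := Set.Infinite.exists_subset_card_eq hinf n
    have hle := card_le_of_separated_of_dist_le T x (by norm_num : (0 : ℝ) < 23 / 25) hR
      (fun c hc => (hTsub hc).2) (fun c hc d hd hcd => dist_sites_ge hA hI (hTsub hc).1 (hTsub hd).1 hcd)
    rw [finrank_euclideanSpace_fin, hTcard] at hle
    linarith
  · refine Set.finite_empty.subset fun s hs => ?_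
    have := hs.2
    linarith [dist_nonneg (x := s) (y := x)]

end Summit.AtomisticToContinuum.Crystallization.Theorems.ExcessDecayLiouville

end
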